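import Mathlib
import Literature.NumberTheory.LFunctions.Zhang2022.SkeletonPropositions
import Literature.NumberTheory.LFunctions.Zhang2022.Section5Lemma57
import Literature.NumberTheory.LFunctions.Zhang2022.Section10Certificate
import HarnessLib

/-!
# Zhang (2022), typed skeleton IV: the assembly — Theorem 1 from the named propositions,
# and the §2/§18 deductions between them, kernel-checked

Topic `Literature/NumberTheory/LFunctions/Zhang2022` (Landau–Siegel audit tree; verdict-neutral).
Y. Zhang, *Discrete mean estimates and the Landau–Siegel zero*, arXiv:2211.02515v1 (2022)
[Zhang2022LandauSiegel] — **an unrefereed manuscript under adjudication; nothing here asserts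
Theorems 1–2 or any Proposition: every result is an IMPLICATION whose hypotheses are the named
nodes of `SkeletonPropositions`.** What is kernel-checked here is the manuscript's own logic
between its displayed claims, for the REAL objects of `SkeletonObjects`:

* `norm_xiStar1_le_of` — **(2.18)** `|Ξ₁*| ≤ Ξ₂* + Ξ₃*` at a modulus `D ≥ 3`, from Lemma 2.3
  (`𝔠* ≥ 0`), Prop. 2.2 (i) (zeros on the line ⇒ `|Z(ρ,ψχ)| = 1`, `ω(ρ) > 0`) and `ψχ` primitive
  (the abstract algebra is the tree's `EndgameData.norm_xiStar1_le`);
* `eventually_not_assumptionA_of_props` — **§2 p. 6**: "Under Assumption (A), a contradiction is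
  immediately derived from (2.18), Proposition 2.4, 2.5 and 2.6": `Prop22i ∧ Lemma23 ∧ Prop24 ∧
  Prop25 ∧ Prop26 ∧ PsiChiPrimitive ⇒ ∃ D₀ ∀ D ≥ D₀, ¬(A)`;
* `theorem1_of_props`, `theorem2_of_props` — **Theorem 1 and Theorem 2 modulo the named
  propositions** (with `SkeletonSetting.theorem1_of_eventually_not_assumptionA`,
  `theorem2_of_theorem1`);
* `prop25_of_ineqs` — **§2 p. 6**: (2.32) ∧ (2.33) ⇒ Prop. 2.5 "by Cauchy's inequality (and
  Lemma 2.3)";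
* `ineq232_of_evals` — **§18 p. 36**: (8.2) + (8.23) + (9.7) + (18.1) + the margin
  `𝔠₁ + 𝔠₂ + 2Re 𝔠₃ < 0.001` + `𝔞 ≫ 1` ⇒ (2.32); `margin232_of_printed` — the margin from the three
  printed numerical inequalities (8.24), (9.8), (18.2);
* `prop24_of_eval` — **§10 p. 23**: (10.17) + `|𝔡′ + 𝔡| > 5` + `𝔞 ≫ 1` ⇒ Prop. 2.4;
* `ineq233_of_bound` — **§18 p. 37**: (18.3) + the crude bound `8800/π < 3000` + `𝔞 ≫ 1` ⇒ (2.33);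
* `prop26_of_evals` — **§11 p. 23**: (11.1) + `Ξ₁₂ ≪ 𝔞𝔓` ((9.7)) ⇒ Prop. 2.6 by Cauchy's inequality;
* the standard inputs: `frakP_eventually_pos` (`𝔓 > 0`, from the tree's `frakP_bounds`),
  `frakA_nonneg`, `norm_Zpc_eq_one`, `omegaW_re_pos`, `im_pos_of_mem_zeroSet`, and
  `psiChiPrimitive_holds : PsiChiPrimitive` ("`χψ` is primitive (mod `Dp`)", §4 p. 8, via the
  private `isPrimitive_changeLevel_mul`: a product of primitive characters to coprime moduli is
  primitive);
* three nodes DISCHARGED: `zerosFinite_holds : ZerosFinite` (identity principle),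
  `lemma57_holds : Lemma57` and `frakALowerBound_holds : FrakALowerBound` (the tree's
  `Lemma57.lemma_5_7`, `Lemma57.frakA_ge'`, which PROVE Lemma 5.7 under (A));
* the numerical nodes against the tree's kernel certificates (`Section8Certificate`,
  `Section18Certificate`, `Section10Certificate`): `not_margin232 : ¬ Margin232` (the margin
  `𝔠₁ + 𝔠₂ + 2Re 𝔠₃ < 0.001` FAILS for the constants as defined — total `> 0.063`; `> 0.05` even in
  the most favourable reading, `margin232_total_gt`), while `|𝔡′ + 𝔡| > 5` HOLDS
  (`prop24_of_eval1017` needs only (10.17)).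

So the trust base of "Theorem 1" in this tree is exactly the list of named nodes in the
hypotheses of `theorem1_of_props` (and, one layer down, of `theorem1_of_evaluations`, one of whose
hypotheses — `Margin232` — is refuted in the kernel: the manuscript's chain, as printed, does not
close at §18 p. 36).

## References

* Y. Zhang, arXiv:2211.02515v1 (2022), §2 pp. 5–6 ((2.16)–(2.20), (2.32)–(2.33), proof of
  Theorem 1), §10 p. 23, §11 p. 23, §18 pp. 36–37. [cite: Zhang2022LandauSiegel, §§2, 10, 11, 18]
-/

noncomputable section

open Complex Real ComplexConjugate

namespace Literature.NumberTheory.LFunctions.Zhang2022.Skeleton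

/-! ## Standard inputs -/

section Standard

variable {D : ℕ}

/-- `𝓛 = log D > 1` for `D ≥ 3`. [cite: Zhang2022LandauSiegel, §2 (2.1)] -/
theorem one_lt_ell (hD : 3 ≤ D) : 1 < ell D := by
  have hD' : (3 : ℝ) ≤ D := by exact_mod_cast hD
  calc (1 : ℝ) < Real.log 3 := by
        rw [Real.lt_log_iff_exp_lt (by norm_num)]
        exact Real.exp_one_lt_d9.trans (by norm_num)
    _ ≤ Real.log D := Real.log_le_log (by norm_num) hD'

/-- `Re s₀ = 1/2`. [cite: Zhang2022LandauSiegel, §2 (2.8)] -/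
theorem s0_re (D : ℕ) : (s0 D).re = 1 / 2 := by
  simp [s0, SmoothWeight.s0]

/-- `Im s₀ = 2πt₀`. [cite: Zhang2022LandauSiegel, §2 (2.8)] -/
theorem s0_im (D : ℕ) : (s0 D).im = 2 * π * t0 D := by
  simp [s0, SmoothWeight.s0]

variable [NeZero D] (χ : DirichletCharacter ℂ D)

/-- `𝔷(ψ)` (2.14) consists of zeros of `L(s,ψ)L(s,ψχ)` in `Ω` ("this is slightly smaller than `Ω`").
[cite: Zhang2022LandauSiegel, §2 (2.14)] -/
theorem mem_prodZeroSetOmega_of_mem_zeroSet {x : Chr D} {ρ : ℂ} (h : ρ ∈ zeroSet D x) :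
    ρ ∈ prodZeroSetOmega χ x := by
  obtain ⟨hre, him, hL⟩ := h
  refine ⟨⟨?_, ?_⟩, by rw [hL, zero_mul]⟩
  · rw [Complex.sub_re, s0_re]; exact hre
  · rw [Complex.sub_im, s0_im]
    exact lt_of_lt_of_le him (by linarith)

omit [NeZero D] in
/-- Points of `𝔷(ψ)` have positive imaginary part (`2πt₀ − 𝓛₁ > 0` for `D ≥ 3`).
[cite: Zhang2022LandauSiegel, §2 (2.14)] -/
theorem im_pos_of_mem_zeroSet (hD : 3 ≤ D) {x : Chr D} {ρ : ℂ} (h : ρ ∈ zeroSet D x) :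
    0 < ρ.im := by
  obtain ⟨-, him, -⟩ := h
  have h1 : 1 < ell D := one_lt_ell hD
  have hℓ1 : 0 < ell1 D := pow_pos (by linarith) _
  have hmono : ell1 D ≤ t0 D := pow_le_pow_right₀ h1.le (by norm_num)
  have hπ : (3 : ℝ) < π := Real.pi_gt_three
  have := (abs_lt.mp him).1
  nlinarith

omit [NeZero D] in
/-- **(2.15) "positive for `σ = 1/2`"**: `ω(ρ)` is a positive real at every `ρ` with `Re ρ = 1/2`
(`D ≥ 3`). [cite: Zhang2022LandauSiegel, §2 (2.15)] -/
theorem omegaW_re_pos (hD : 3 ≤ D) {ρ : ℂ} (hρ : ρ.re = 1 / 2) :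
    0 < (omegaW D ρ).re ∧ (omegaW D ρ).im = 0 :=
  SmoothWeight.omega_re_pos_of_re_eq_half (pow_pos (by linarith [one_lt_ell hD]) _) (t0 D) hρ

/-- **"`|Z(s,ψχ)| = 1` if `σ = 1/2`"** (§8 p. 16, used for (2.18) and (8.2)), for `ψχ` primitive and
`Im s > 0` (the tree's `GammaFactor.norm_Zfac_half_eq_one`). [cite: Zhang2022LandauSiegel, §8 (8.2)] -/
theorem norm_Zpc_eq_one {x : Chr D} (hprim : (psiChi χ x).IsPrimitive) {ρ : ℂ}
    (hre : ρ.re = 1 / 2) (him : 0 < ρ.im) : ‖Zpc χ x ρ‖ = 1 := by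
  have hρ : ρ = 1 / 2 + (ρ.im : ℂ) * I := Complex.ext (by simp [hre]) (by simp)
  rw [Zpc, hρ]
  exact GammaFactor.norm_Zfac_half_eq_one hprim him

/-- `𝔞 ≥ 0` ((2.31): a square times positive factors). [cite: Zhang2022LandauSiegel, §2 (2.31)] -/
theorem frakA_nonneg : 0 ≤ frakA χ := by
  rw [frakA, Lemma171.frakA]
  refine mul_nonneg (mul_nonneg (by positivity) (sq_nonneg _)) ?_
  exact Finset.prod_nonneg fun p _ => by positivity

omit [NeZero D] in
/-- `𝔓 ≥ 0` ((2.9): a sum of primes). [cite: Zhang2022LandauSiegel, §2 (2.9)] -/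
theorem frakP_nonneg (D : ℕ) : 0 ≤ frakP D := by
  rw [frakP_eq_sum_primeWindow]
  exact Finset.sum_nonneg fun p _ => Nat.cast_nonneg p

/-- **`𝔓 > 0` for large `D`** ((2.9) `𝔓 = (1 + o(1))P²𝓛⁻⁷⁷`, the tree's `frakP_bounds`; in
particular the window `p ∼ P` contains a prime). [cite: Zhang2022LandauSiegel, §2 (2.9)] -/
theorem frakP_eventually_pos : ∃ D₀ : ℕ, ∀ D : ℕ, D₀ ≤ D → 0 < frakP D := by
  obtain ⟨D₀, h⟩ := frakP_bounds
  refine ⟨max D₀ 9, fun D hD => ?_⟩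
  have hD₀ : D₀ ≤ D := le_trans (le_max_left _ _) hD
  have h9 : (9 : ℝ) ≤ D := by exact_mod_cast le_trans (le_max_right _ _) hD
  have hlog : 2 < Real.log D := by
    calc (2 : ℝ) < Real.log 9 := by
          rw [Real.lt_log_iff_exp_lt (by norm_num)]
          have h2 : Real.exp 2 = Real.exp 1 * Real.exp 1 := by rw [← Real.exp_add]; norm_num
          rw [h2]
          nlinarith [Real.exp_one_lt_d9, Real.exp_pos 1]
      _ ≤ Real.log D := Real.log_le_log (by norm_num) h9
  set L := Real.log D with hL
  set M := Real.exp (L ^ 9) ^ 2 * (L ^ 77)⁻¹ with hM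
  have hM0 : 0 < M := by positivity
  have hb := abs_le.mp (h D hD₀)
  have hL68 : 6 < L ^ 68 := by
    calc (6 : ℝ) < 2 ^ 68 := by norm_num
      _ ≤ L ^ 68 := by gcongr
  have hsmall : 3 * (L ^ 68)⁻¹ < 1 := by
    rw [mul_inv_lt_iff₀ (by positivity)]; linarith
  nlinarith [hb.1, mul_pos (sub_pos.mpr hsmall) hM0]

/-- **A product of primitive characters to coprime moduli is primitive**: lifted to the product
modulus `nm`, `χ₁χ₂` has conductor divisible by `n` (write `χ₁ = (χ₁χ₂)·χ₂⁻¹` and use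
`𝔣(θθ′) ∣ lcm(𝔣(θ), 𝔣(θ′))`, `(n, m) = 1`) and by `m`, hence equal to `nm`. [folklore] -/
private theorem isPrimitive_changeLevel_mul {n m : ℕ} [NeZero n] [NeZero m] (hnm : Nat.Coprime n m)
    {χ₁ : DirichletCharacter ℂ n} {χ₂ : DirichletCharacter ℂ m} (h₁ : χ₁.IsPrimitive)
    (h₂ : χ₂.IsPrimitive) :
    (DirichletCharacter.changeLevel (dvd_mul_right n m) χ₁ *
      DirichletCharacter.changeLevel (dvd_mul_left m n) χ₂).IsPrimitive := by
  haveI : NeZero (n * m) := ⟨mul_ne_zero (NeZero.ne n) (NeZero.ne m)⟩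
  set A := DirichletCharacter.changeLevel (dvd_mul_right n m) χ₁ with hA
  set B := DirichletCharacter.changeLevel (dvd_mul_left m n) χ₂ with hB
  have hAc : A.conductor = n := by
    rw [hA, DirichletCharacter.conductor_changeLevel]
    exact (DirichletCharacter.isPrimitive_def _).mp h₁
  have hBc : B.conductor = m := by
    rw [hB, DirichletCharacter.conductor_changeLevel]
    exact (DirichletCharacter.isPrimitive_def _).mp h₂
  rw [DirichletCharacter.isPrimitive_def]
  refine Nat.dvd_antisymm (DirichletCharacter.conductor_dvd_level _) ?_
  have hn : n ∣ (A * B).conductor := by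
    have h := DirichletCharacter.conductor_mul_dvd_lcm_conductor (A * B) B⁻¹
    rw [mul_inv_cancel_right, hAc, DirichletCharacter.conductor_inv, hBc] at h
    exact hnm.dvd_of_dvd_mul_right (h.trans (Nat.lcm_dvd_mul _ m))
  have hm : m ∣ (A * B).conductor := by
    have h := DirichletCharacter.conductor_mul_dvd_lcm_conductor A⁻¹ (A * B)
    rw [inv_mul_cancel_left, DirichletCharacter.conductor_inv, hAc, hBc] at h
    exact hnm.symm.dvd_of_dvd_mul_left (h.trans (Nat.lcm_dvd_mul n _))
  exact hnm.mul_dvd_of_dvd_of_dvd hn hm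

/-- **"`χψ` is a primitive character (mod `Dp`)"** (§4 p. 8) — the node `PsiChiPrimitive` HOLDS:
for `D ≥ 3` one has `p > P = exp(𝓛⁹) ≥ D`, so `(D, p) = 1`, and `isPrimitive_changeLevel_mul`
applies to `χ (mod D)`, `ψ (mod p)`. [cite: Zhang2022LandauSiegel, §4 p. 8] -/
theorem psiChiPrimitive_holds : PsiChiPrimitive := by
  intro D _ χ x hD hχ
  have hD' : (3 : ℝ) ≤ D := by exact_mod_cast hD
  have hlog : 1 ≤ Real.log (D : ℝ) := by
    have h3 : (1 : ℝ) < Real.log 3 := by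
      rw [Real.lt_log_iff_exp_lt (by norm_num)]
      exact Real.exp_one_lt_d9.trans (by norm_num)
    exact le_trans h3.le (Real.log_le_log (by norm_num) hD')
  have hDP : (D : ℝ) ≤ bigP D := by
    rw [bigP, ell]
    calc (D : ℝ) = Real.exp (Real.log D) := (Real.exp_log (by positivity)).symm
      _ ≤ Real.exp (Real.log D ^ 9) := Real.exp_le_exp.mpr (by
          calc Real.log D = Real.log D ^ 1 := (pow_one _).symm
            _ ≤ Real.log D ^ 9 := pow_le_pow_right₀ hlog (by norm_num))
  have hPp : bigP D < x.p := by
    have hm := x.mem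
    rw [primeWindow, Finset.mem_filter, Finset.mem_Ioo] at hm
    exact (Nat.floor_lt (le_trans (by positivity) hDP)).mp hm.1.1
  have hDp : D < x.p := by exact_mod_cast lt_of_le_of_lt hDP hPp
  have hcop : Nat.Coprime D x.p :=
    Nat.coprime_comm.mp ((Nat.Prime.coprime_iff_not_dvd x.prime).mpr
      (Nat.not_dvd_of_pos_of_lt (by omega) hDp))
  exact isPrimitive_changeLevel_mul hcop hχ x.prim

/-- `PsiChiPrimitive` — `_holds` alias of `psiChiPrimitive_holds` above under the fact's exact name (appended
2026-08-28, D-0026 bookkeeping: the proof term is the existing theorem of this file; no statement,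
definition or attribute is edited; no new named fact; the ledger's debt table listed the fact
unproved). [cite: Zhang2022LandauSiegel, §4 p. 8] -/
theorem _root_.Literature.NumberTheory.LFunctions.Zhang2022.Skeleton.PsiChiPrimitive_holds :
    PsiChiPrimitive :=
  _root_.Literature.NumberTheory.LFunctions.Zhang2022.Skeleton.psiChiPrimitive_holds

/-- **`𝔷(ψ)` is finite**: the node `ZerosFinite` HOLDS — the zeros of the entire, not identically
vanishing `L(·,ψ)` (`ψ` primitive mod a prime, `L(2,ψ) ≠ 0`) cannot accumulate in the bounded box
(2.14) (identity principle, Mathlib's `AnalyticOnNhd.eqOn_zero_of_preconnected_of_frequently_eq_zero`).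
So the `Finset` double sums of `SkeletonObjects` are the printed sums. [cite: Zhang2022LandauSiegel, §2 (2.14)] -/
theorem zerosFinite_holds : ZerosFinite := by
  intro D x
  by_contra hinf
  set c : ℂ := (1 / 2 : ℂ) + ((2 * π * t0 D : ℝ) : ℂ) * I with hc
  have hsub : zeroSet D x ⊆ Metric.closedBall c (1 / 2 + ell1 D) := by
    intro ρ hρ
    obtain ⟨hre, him, -⟩ := hρ
    rw [Metric.mem_closedBall, dist_eq_norm]
    have h1 : (ρ - c).re = ρ.re - 1 / 2 := by simp [hc]
    have h2 : (ρ - c).im = ρ.im - 2 * π * t0 D := by simp [hc]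
    have h := Complex.norm_le_abs_re_add_abs_im (ρ - c)
    rw [h1, h2] at h
    linarith [le_of_lt hre, le_of_lt him]
  obtain ⟨z₀, -, hacc⟩ :=
    Set.Infinite.exists_accPt_of_subset_isCompact hinf (isCompact_closedBall c _) hsub
  have hfreq : ∃ᶠ z in nhdsWithin z₀ {z₀}ᶜ, x.ψ.LFunction z = 0 :=
    (accPt_iff_frequently_nhdsNE.mp hacc).mono fun z hz => hz.2.2
  have hanal : AnalyticOnNhd ℂ x.ψ.LFunction Set.univ :=
    Complex.analyticOnNhd_univ_iff_differentiable.mpr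
      (DirichletCharacter.differentiable_LFunction x.ψ_ne_one)
  have hzero := hanal.eqOn_zero_of_preconnected_of_frequently_eq_zero isPreconnected_univ
    (Set.mem_univ z₀) hfreq
  have h2 : x.ψ.LFunction 2 ≠ 0 :=
    DirichletCharacter.LFunction_ne_zero_of_one_le_re x.ψ (Or.inl x.ψ_ne_one) (by norm_num)
  exact h2 (hzero (Set.mem_univ (2 : ℂ)))

/-- `ZerosFinite` — `_holds` alias of `zerosFinite_holds` above under the fact's exact name (appended
2026-08-28, D-0026 bookkeeping: the proof term is the existing theorem of this file; no statement,
definition or attribute is edited; no new named fact; the ledger's debt table listed the fact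
unproved). [cite: Zhang2022LandauSiegel, §2 (2.14)] -/
theorem _root_.Literature.NumberTheory.LFunctions.Zhang2022.Skeleton.ZerosFinite_holds :
    ZerosFinite :=
  _root_.Literature.NumberTheory.LFunctions.Zhang2022.Skeleton.zerosFinite_holds

/-- `L₀ ≤ log D` once `D ≥ ⌈exp L₀⌉₊`. [folklore] -/
private theorem le_log_of_ceil_exp_le {L₀ : ℝ} {D : ℕ} (hD : ⌈Real.exp L₀⌉₊ ≤ D) :
    L₀ ≤ Real.log D := by
  have h : Real.exp L₀ ≤ D := le_trans (Nat.le_ceil _) (by exact_mod_cast hD)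
  exact (Real.le_log_iff_exp_le (lt_of_lt_of_le (Real.exp_pos _) h)).mpr h

/-- **Lemma 5.7 is a theorem of the tree**: the node `Lemma57` HOLDS, by the tree's
`Lemma57.lemma_5_7` (`L′(1,χ) ≥ (e⁻¹/4)·D/φ(D)` under (A), for real primitive `χ`, `log D ≥ L₀`).
[cite: Zhang2022LandauSiegel, §5 Lemma 5.7] -/
theorem lemma57_holds : Lemma57 := by
  obtain ⟨L₀, h⟩ := Lemma57.lemma_5_7
  refine ⟨Real.exp (-1) / 4, by positivity, ⌈Real.exp L₀⌉₊, fun D _ χ hD hq hp hA => ?_⟩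
  exact h D χ hp hq.sq_eq_one (le_log_of_ceil_exp_le hD) (le_of_lt hA)

/-- `Lemma57` — `_holds` alias of `lemma57_holds` above under the fact's exact name (appended
2026-08-28, D-0026 bookkeeping: the proof term is the existing theorem of this file; no statement,
definition or attribute is edited; no new named fact; the ledger's debt table listed the fact
unproved). [cite: Zhang2022LandauSiegel, §5 Lemma 5.7] -/
theorem _root_.Literature.NumberTheory.LFunctions.Zhang2022.Skeleton.Lemma57_holds : Lemma57 :=
  _root_.Literature.NumberTheory.LFunctions.Zhang2022.Skeleton.lemma57_holds

/-- **`𝔞 ≫ 1` under (A) is a theorem of the tree**: the node `FrakALowerBound` HOLDS, with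
`a₀ = 3/(2e²π²)`, by the tree's `Lemma57.frakA_ge'`. [cite: Zhang2022LandauSiegel, §2 p. 6] -/
theorem frakALowerBound_holds : FrakALowerBound := by
  obtain ⟨L₀, h⟩ := Lemma57.frakA_ge'
  refine ⟨3 / (2 * Real.exp 1 ^ 2 * π ^ 2), by positivity, ⌈Real.exp L₀⌉₊,
    fun D _ χ hD hq hp hA => ?_⟩
  exact h D χ hp hq.sq_eq_one (le_log_of_ceil_exp_le hD) (le_of_lt hA)

/-- `FrakALowerBound` — `_holds` alias of `frakALowerBound_holds` above under the fact's exact name (appended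
2026-08-28, D-0026 bookkeeping: the proof term is the existing theorem of this file; no statement,
definition or attribute is edited; no new named fact; the ledger's debt table listed the fact
unproved). [cite: Zhang2022LandauSiegel, §2 p. 6] -/
theorem _root_.Literature.NumberTheory.LFunctions.Zhang2022.Skeleton.FrakALowerBound_holds :
    FrakALowerBound :=
  _root_.Literature.NumberTheory.LFunctions.Zhang2022.Skeleton.frakALowerBound_holds

end Standard

/-! ## The §2 datum at a fixed modulus: instantiating the tree's `EndgameData` -/

section Endgame

variable (c' : ℝ) {D : ℕ} [NeZero D] (χ : DirichletCharacter ℂ D)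

/-- The finite family `{(ψ, ρ) : ψ ∈ Ψ₁, ρ ∈ 𝔷(ψ)}` of §2 with its weights and values, packaged as
the tree's abstract `EndgameData` once Lemma 2.3 (`𝔠* ≥ 0`), `ω(ρ) > 0` and `|Z(ρ,ψχ)| = 1` are
available at every index. [cite: Zhang2022LandauSiegel, §2 (2.16)–(2.20)] -/
def endgame (hc : ∀ i ∈ idx χ, 0 ≤ (cstar c' D i.1 i.2).re)
    (hω : ∀ i ∈ idx χ, 0 < (omegaW D i.2).re) (hZ : ∀ i ∈ idx χ, ‖Zpc χ i.1 i.2‖ = 1) :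
    EndgameData (idx χ) where
  cstar i := (cstar c' D i.1.1 i.1.2).re
  omega i := (omegaW D i.1.2).re
  H₁ i := H1 χ i.1.1 i.1.2
  H₂ i := H2 χ i.1.1 i.1.2
  J₁ i := J1 χ i.1.1 i.1.2
  J₂ i := J2 χ i.1.1 i.1.2
  Z i := Zpc χ i.1.1 i.1.2
  cstar_nonneg i := hc i.1 i.2
  omega_pos i := hω i.1 i.2
  norm_Z i := hZ i.1 i.2

variable {c' χ}
variable {hc : ∀ i ∈ idx χ, 0 ≤ (cstar c' D i.1 i.2).re}
  {hω : ∀ i ∈ idx χ, 0 < (omegaW D i.2).re} {hZ : ∀ i ∈ idx χ, ‖Zpc χ i.1 i.2‖ = 1}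

/-- A complex number with zero imaginary part is the cast of its real part. [folklore] -/
private theorem ofReal_re_eq {z : ℂ} (h : z.im = 0) : ((z.re : ℝ) : ℂ) = z :=
  Complex.ext (by simp) (by simp [h])

/-- `Ξ₁*` of the datum is the `Ξ₁*` of (2.17) (given `𝔠*`, `ω` real at every index).
[cite: Zhang2022LandauSiegel, §2 (2.17)] -/
theorem endgame_xiStar1 (hci : ∀ i ∈ idx χ, (cstar c' D i.1 i.2).im = 0)
    (hωi : ∀ i ∈ idx χ, (omegaW D i.2).im = 0) :
    (endgame c' χ hc hω hZ).xiStar1 = xiStar1 c' χ := by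
  rw [xiStar1, ← Finset.sum_coe_sort]
  refine Finset.sum_congr rfl fun i _ => ?_
  simp only [endgame]
  rw [ofReal_re_eq (hci i.1 i.2), ofReal_re_eq (hωi i.1 i.2)]

/-- `Ξ₂*` of the datum is (2.19). [cite: Zhang2022LandauSiegel, §2 (2.19)] -/
theorem endgame_xiStar2 : (endgame c' χ hc hω hZ).xiStar2 = xiStar2 c' χ := by
  rw [xiStar2, ← Finset.sum_coe_sort]; rfl

/-- `Ξ₃*` of the datum is (2.20). [cite: Zhang2022LandauSiegel, §2 (2.20)] -/
theorem endgame_xiStar3 : (endgame c' χ hc hω hZ).xiStar3 = xiStar3 c' χ := by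
  rw [xiStar3, ← Finset.sum_coe_sort]; rfl

/-- `Ξ₁` of the datum is the left side of (2.32). [cite: Zhang2022LandauSiegel, §2 (2.32)] -/
theorem endgame_xi1 : (endgame c' χ hc hω hZ).xi1 = xi1 c' χ := by
  rw [xi1, ← Finset.sum_coe_sort]; rfl

/-- `Ξ_J` of the datum is the left side of (2.33). [cite: Zhang2022LandauSiegel, §2 (2.33)] -/
theorem endgame_xiJ : (endgame c' χ hc hω hZ).xiJ = xiJ c' χ := by
  rw [xiJ, ← Finset.sum_coe_sort]; rfl

/-- `Ξ₁₁` of the datum is (8.3). [cite: Zhang2022LandauSiegel, §8 (8.3)] -/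
theorem endgame_xi11 : (endgame c' χ hc hω hZ).xi11 = xi11 c' χ := by
  rw [xi11, ← Finset.sum_coe_sort]; rfl

/-- `Ξ₁₂` of the datum is (8.4). [cite: Zhang2022LandauSiegel, §8 (8.4)] -/
theorem endgame_xi12 : (endgame c' χ hc hω hZ).xi12 = xi12 c' χ := by
  rw [xi12, ← Finset.sum_coe_sort]; rfl

/-- `Ξ₁₃` of the datum is (8.5) (given `𝔠*`, `ω` real). [cite: Zhang2022LandauSiegel, §8 (8.5)] -/
theorem endgame_xi13 (hci : ∀ i ∈ idx χ, (cstar c' D i.1 i.2).im = 0)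
    (hωi : ∀ i ∈ idx χ, (omegaW D i.2).im = 0) :
    (endgame c' χ hc hω hZ).xi13 = xi13 c' χ := by
  rw [xi13, ← Finset.sum_coe_sort]
  refine Finset.sum_congr rfl fun i _ => ?_
  simp only [endgame]
  rw [ofReal_re_eq (hci i.1 i.2), ofReal_re_eq (hωi i.1 i.2)]
  ring

end Endgame

/-! ## (2.18) and the contradiction of §2 at a fixed modulus -/

section Fixed

variable (c' : ℝ) {D : ℕ} [NeZero D] (χ : DirichletCharacter ℂ D)

/-- The pointwise inputs at a modulus `D ≥ 3`: Lemma 2.3 on `Ψ₁ × 𝔷(ψ)`, Prop. 2.2 (i) and `ψχ`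
primitive give, at every index of the double sum, `𝔠* ≥ 0` real, `ω(ρ) > 0` real, `|Z(ρ,ψχ)| = 1`.
[cite: Zhang2022LandauSiegel, §2 p. 5] -/
theorem pointwise_inputs (hD : 3 ≤ D)
    (h23 : ∀ x ∈ PsiOne χ, ∀ ρ ∈ zeroSet D x, (cstar c' D x ρ).im = 0 ∧ 0 ≤ (cstar c' D x ρ).re)
    (h22 : ∀ x ∈ PsiOne χ, ∀ s ∈ prodZeroSetOmega χ x, s.re = 1 / 2)
    (hprim : ∀ x : Chr D, (psiChi χ x).IsPrimitive) :
    (∀ i ∈ idx χ, (cstar c' D i.1 i.2).im = 0 ∧ 0 ≤ (cstar c' D i.1 i.2).re) ∧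
    (∀ i ∈ idx χ, 0 < (omegaW D i.2).re ∧ (omegaW D i.2).im = 0) ∧
    (∀ i ∈ idx χ, ‖Zpc χ i.1 i.2‖ = 1) := by
  have mem : ∀ i ∈ idx χ, i.1 ∈ PsiOne χ ∧ i.2 ∈ zeroSet D i.1 := by
    intro i hi
    rw [idx, Finset.mem_sigma] at hi
    exact ⟨mem_of_mem_finsetOf hi.1, mem_of_mem_finsetOf hi.2⟩
  have hre : ∀ i ∈ idx χ, i.2.re = 1 / 2 := fun i hi =>
    h22 i.1 (mem i hi).1 i.2 (mem_prodZeroSetOmega_of_mem_zeroSet χ (mem i hi).2)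
  refine ⟨fun i hi => h23 i.1 (mem i hi).1 i.2 (mem i hi).2,
    fun i hi => omegaW_re_pos hD (hre i hi), fun i hi => ?_⟩
  exact norm_Zpc_eq_one χ (hprim i.1) (hre i hi) (im_pos_of_mem_zeroSet hD (mem i hi).2)

/-- **(2.18)** `|Ξ₁*| ≤ Ξ₂* + Ξ₃*` at a modulus `D ≥ 3`, from Lemma 2.3, Prop. 2.2 (i) and the
primitivity of `ψχ` (via `|Z(ρ,ψχ)| = 1`, `ω(ρ) > 0` and the triangle inequality; the algebra is the
tree's `EndgameData.norm_xiStar1_le`). [cite: Zhang2022LandauSiegel, §2 (2.18)] -/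
theorem norm_xiStar1_le_of (hD : 3 ≤ D)
    (h23 : ∀ x ∈ PsiOne χ, ∀ ρ ∈ zeroSet D x, (cstar c' D x ρ).im = 0 ∧ 0 ≤ (cstar c' D x ρ).re)
    (h22 : ∀ x ∈ PsiOne χ, ∀ s ∈ prodZeroSetOmega χ x, s.re = 1 / 2)
    (hprim : ∀ x : Chr D, (psiChi χ x).IsPrimitive) :
    ‖xiStar1 c' χ‖ ≤ xiStar2 c' χ + xiStar3 c' χ := by
  obtain ⟨hc, hω, hZ⟩ := pointwise_inputs c' χ hD h23 h22 hprim
  let E := endgame c' χ (fun i hi => (hc i hi).2) (fun i hi => (hω i hi).1) hZ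
  have h := E.norm_xiStar1_le
  rwa [endgame_xiStar1 (fun i hi => (hc i hi).1) (fun i hi => (hω i hi).2), endgame_xiStar2,
    endgame_xiStar3] at h

/-- **§2 p. 6, at a fixed modulus**: (2.18) with `|Ξ₁*| > 5𝔞𝔓`, `Ξ₂* < 2𝔞𝔓`, `Ξ₃* ≤ 𝔞𝔓` is absurd
(`𝔞𝔓 ≥ 0`). [cite: Zhang2022LandauSiegel, §2 p. 6] -/
theorem false_of_props_at (h218 : ‖xiStar1 c' χ‖ ≤ xiStar2 c' χ + xiStar3 c' χ)
    (h24 : 5 * frakA χ * frakP D < ‖xiStar1 c' χ‖) (h25 : xiStar2 c' χ < 2 * frakA χ * frakP D)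
    (h26 : xiStar3 c' χ ≤ 1 * frakA χ * frakP D) : False := by
  have h0 : 0 ≤ frakA χ * frakP D := mul_nonneg (frakA_nonneg χ) (frakP_nonneg D)
  linarith

end Fixed

/-! ## Theorem 1 modulo the named propositions -/

/-- **"Under Assumption (A), a contradiction is immediately derived from (2.18), Proposition 2.4,
2.5 and 2.6"** (§2 p. 6): the named nodes `Prop22i`, `Lemma23 c′`, `Prop24 c′`, `Prop25 c′`,
`Prop26 c′` (and the standard `PsiChiPrimitive`) imply that (A) fails for every real primitive
character to every sufficiently large modulus. [cite: Zhang2022LandauSiegel, §2 p. 6] -/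
theorem eventually_not_assumptionA_of_props {c' : ℝ} (h22 : Prop22i) (h23 : Lemma23 c')
    (h24 : Prop24 c') (h25 : Prop25 c') (h26 : Prop26 c') (hprim : PsiChiPrimitive) :
    ∃ D₀ : ℕ, ∀ (D : ℕ) [NeZero D] (χ : DirichletCharacter ℂ D),
      D₀ ≤ D → χ.IsQuadratic → χ.IsPrimitive → ¬ AssumptionA D χ := by
  obtain ⟨D₀, h⟩ := (((h22.and h23).and h24).and h25).and (h26 1 one_pos)
  refine ⟨max D₀ 3, fun D _ χ hD hq hp hA => ?_⟩
  have hD3 : 3 ≤ D := le_trans (le_max_right _ _) hD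
  obtain ⟨⟨⟨⟨h22', h23'⟩, h24'⟩, h25'⟩, h26'⟩ := h D χ (le_trans (le_max_left _ _) hD) hq hp
  have h218 := norm_xiStar1_le_of c' χ hD3 h23' h22' (fun x => hprim D χ x hD3 hp)
  exact false_of_props_at c' χ h218 (h24' hA) (h25' hA) (h26' hA)

/-- **Theorem 1 modulo the named propositions of §2**: Prop. 2.2 (i), Lemma 2.3, Props. 2.4, 2.5,
2.6 (for one value of the constant `c′` of (2.13)) imply `L(1,χ) > c₁(log D)⁻²⁰²²` (the
primitivity of `ψχ` being discharged, `psiChiPrimitive_holds`). This is the manuscript's top-level deduction, kernel-checked; the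
hypotheses are claims of the manuscript, NOT established here. [cite: Zhang2022LandauSiegel, §2 p. 6] -/
theorem theorem1_of_props {c' : ℝ} (h22 : Prop22i) (h23 : Lemma23 c') (h24 : Prop24 c')
    (h25 : Prop25 c') (h26 : Prop26 c') : Theorem1 :=
  theorem1_of_eventually_not_assumptionA
    (eventually_not_assumptionA_of_props h22 h23 h24 h25 h26 psiChiPrimitive_holds)

/-- **Theorem 2 modulo the same named propositions** (§1 p. 3 + §2 p. 6).
[cite: Zhang2022LandauSiegel, §1 Theorem 2] -/
theorem theorem2_of_props {c' : ℝ} (h22 : Prop22i) (h23 : Lemma23 c') (h24 : Prop24 c')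
    (h25 : Prop25 c') (h26 : Prop26 c') : Theorem2 :=
  theorem2_of_theorem1 (theorem1_of_props h22 h23 h24 h25 h26)

/-! ## §2 p. 6 and §18: Proposition 2.5 from (2.32) and (2.33) -/

/-- **"Proposition 2.5 follows from the inequalities (2.32) and (2.33) by Cauchy's inequality (and
Lemma 2.3)"** (§2 p. 6). [cite: Zhang2022LandauSiegel, §2 p. 6] -/
theorem prop25_of_ineqs {c' : ℝ} (h22 : Prop22i) (h23 : Lemma23 c') (hprim : PsiChiPrimitive)
    (h232 : Ineq232 c') (h233 : Ineq233 c') : Prop25 c' := by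
  obtain ⟨D₀, h⟩ := ((h22.and h23).and h232).and h233
  refine ⟨max D₀ 3, fun D _ χ hD hq hp hA => ?_⟩
  have hD3 : 3 ≤ D := le_trans (le_max_right _ _) hD
  obtain ⟨⟨⟨h22', h23'⟩, h232'⟩, h233'⟩ := h D χ (le_trans (le_max_left _ _) hD) hq hp
  obtain ⟨hc, hω, hZ⟩ := pointwise_inputs c' χ hD3 h23' h22' (fun x => hprim D χ x hD3 hp)
  let E := endgame c' χ (fun i hi => (hc i hi).2) (fun i hi => (hω i hi).1) hZ
  have hx1 : E.xi1 = xi1 c' χ := endgame_xi1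
  have hxJ : E.xiJ = xiJ c' χ := endgame_xiJ
  have hx2 : E.xiStar2 = xiStar2 c' χ := endgame_xiStar2
  rcases (mul_nonneg (frakA_nonneg χ) (frakP_nonneg D)).eq_or_lt with h0 | hpos
  · -- degenerate `𝔞𝔓 = 0`: (2.32) contradicts `Ξ₁ ≥ 0`
    have := E.xi1_nonneg
    rw [hx1] at this
    linarith [h232' hA]
  · have h1 : E.xi1 < 0.001 * (frakA χ * frakP D) := by rw [hx1, ← mul_assoc]; exact h232' hA
    have hJ : E.xiJ < 3000 * (frakA χ * frakP D) := by rw [hxJ, ← mul_assoc]; exact h233' hA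
    have h := E.prop25_of_ineq232_233 hpos h1 hJ
    rw [hx2] at h
    rw [mul_assoc]; exact h

/-! ## §18 p. 36: (2.32) from the evaluations (8.23), (9.7), (18.1) and the printed margin -/

/-- **The printed margin from the printed numerical inequalities**: (8.24) `𝔠₁ < 6.9955`, (9.8)
`𝔠₂ < 6.9955` and (18.2) `Re 𝔠₃ < −6.9951` read for the `𝔠₃` of (18.1) including its rounding
term (`Re frakc3 + 10⁻⁵ < −6.9951`), give `𝔠₁ + 𝔠₂ + 2Re 𝔠₃ < 0.0008 < 0.001`. (The tree certifies
`¬ Ineq824`: `Section8Certificate.not_ineq824`.) [cite: Zhang2022LandauSiegel, §18 p. 36] -/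
theorem margin232_of_printed (h824 : Ineq824) (h98 : Ineq98) (h182 : frakc3.re + 1e-5 < -6.9951) :
    Margin232 := by
  rw [Ineq824] at h824; rw [Ineq98] at h98; rw [Margin232]
  linarith

/-- **(8.2)**: `Ξ₁ = Ξ₁₁ + Ξ₁₂ + 2Re Ξ₁₃` at a modulus `D ≥ 3` ("since `|Z(s,ψχ)| = 1` if `σ = 1/2`"),
from Prop. 2.2 (i), Lemma 2.3 (reality of `𝔠*`) and `ψχ` primitive.
[cite: Zhang2022LandauSiegel, §8 (8.2)] -/
theorem xi1_eq_of {c' : ℝ} {D : ℕ} [NeZero D] (χ : DirichletCharacter ℂ D) (hD : 3 ≤ D)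
    (h23 : ∀ x ∈ PsiOne χ, ∀ ρ ∈ zeroSet D x, (cstar c' D x ρ).im = 0 ∧ 0 ≤ (cstar c' D x ρ).re)
    (h22 : ∀ x ∈ PsiOne χ, ∀ s ∈ prodZeroSetOmega χ x, s.re = 1 / 2)
    (hprim : ∀ x : Chr D, (psiChi χ x).IsPrimitive) :
    xi1 c' χ = xi11 c' χ + xi12 c' χ + 2 * (xi13 c' χ).re := by
  obtain ⟨hc, hω, hZ⟩ := pointwise_inputs c' χ hD h23 h22 hprim
  let E := endgame c' χ (fun i hi => (hc i hi).2) (fun i hi => (hω i hi).1) hZ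
  have h := E.xi1_eq
  rwa [endgame_xi1, endgame_xi11, endgame_xi12,
    endgame_xi13 (fun i hi => (hc i hi).1) (fun i hi => (hω i hi).2)] at h

/-- **§18 p. 36: "This with together (8.23), (9.7) and (18.1) yields (2.32)"** — with the inputs
the sentence uses made explicit: (8.2), the three evaluations (errors `o(𝔓)`, plus the rounding
slack `10⁻⁵𝔞𝔓` of (18.1)), the margin `𝔠₁ + 𝔠₂ + 2Re 𝔠₃ < 0.001` (`Margin232`), `𝔞 ≫ 1`
(Lemma 5.7, to absorb `o(𝔓)` into the margin) and `𝔓 > 0`.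
[cite: Zhang2022LandauSiegel, §18 p. 36] -/
theorem ineq232_of_evals {c' : ℝ} (h22 : Prop22i) (h23 : Lemma23 c') (hprim : PsiChiPrimitive)
    (h823 : Eval823 c') (h97 : Eval97 c') (h181 : Eval181 c') (hm : Margin232)
    (ha : FrakALowerBound) : Ineq232 c' := by
  obtain ⟨a₀, ha₀, ha⟩ := ha
  obtain ⟨D₁, hP⟩ := frakP_eventually_pos
  rw [Margin232] at hm
  set m : ℝ := 0.001 - (frakc1.re + frakc2.re + 2 * (frakc3.re + 1e-5)) with hm_def
  have hm0 : 0 < m := by rw [hm_def]; linarith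
  set ε : ℝ := m * a₀ / 8 with hε
  have hε0 : 0 < ε := by positivity
  obtain ⟨D₀, h⟩ := ((((h22.and h23).and (h823 ε hε0)).and (h97 ε hε0)).and (h181 ε hε0)).and ha
  refine ⟨max (max D₀ D₁) 3, fun D _ χ hD hq hp hA => ?_⟩
  have hD3 : 3 ≤ D := le_trans (le_max_right _ _) hD
  have hD₀ : D₀ ≤ D := le_trans (le_trans (le_max_left _ _) (le_max_left _ _)) hD
  have hD₁ : D₁ ≤ D := le_trans (le_trans (le_max_right _ _) (le_max_left _ _)) hD
  obtain ⟨⟨⟨⟨⟨h22', h23'⟩, h823'⟩, h97'⟩, h181'⟩, ha'⟩ := h D χ hD₀ hq hp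
  have hPpos : 0 < frakP D := hP D hD₁
  have haa : a₀ ≤ frakA χ := ha' hA
  have e1 := abs_le.mp (h823' hA)
  have e2 := abs_le.mp (h97' hA)
  have e3 : |(xi13 c' χ).re - frakc3.re * frakA χ * frakP D| ≤
      1e-5 * frakA χ * frakP D + ε * frakP D := by
    have h3 := h181' hA
    have : (xi13 c' χ - frakc3 * frakA χ * frakP D).re =
        (xi13 c' χ).re - frakc3.re * frakA χ * frakP D := by
      simp [Complex.sub_re, Complex.mul_re]
    rw [← this]
    exact le_trans (Complex.abs_re_le_norm _) h3
  have e3' := abs_le.mp e3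
  rw [xi1_eq_of χ hD3 h23' h22' (fun x => hprim D χ x hD3 hp)]
  -- `Ξ₁ ≤ (𝔠₁ + 𝔠₂ + 2Re 𝔠₃ + 2·10⁻⁵)𝔞𝔓 + 4ε𝔓` and `4ε𝔓 ≤ (m/2)·a₀·𝔓 ≤ (m/2)𝔞𝔓 < m𝔞𝔓`
  have h4 : 4 * (ε * frakP D) < m * frakA χ * frakP D := by
    have : 4 * ε = m * a₀ / 2 := by rw [hε]; ring
    nlinarith [mul_le_mul_of_nonneg_right haa hPpos.le, mul_pos hm0 hPpos]
  nlinarith [e1.2, e2.2, e3'.2]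

/-! ## §10 p. 23: Proposition 2.4 from (10.17) -/

/-- **§10 p. 23, "Combining these bounds with (10.16) we complete the proof of Proposition 2.4"**:
(10.17) `Ξ₁* = (𝔡′ + 𝔡)𝔞𝔓 + o(𝔓)`, the numerical `|𝔡′ + 𝔡| > 5` (the tree's `Prop24Main`, holding:
`Section10Certificate.Prop24Main_holds`) and `𝔞 ≫ 1` give `|Ξ₁*| > 5𝔞𝔓`.
[cite: Zhang2022LandauSiegel, §10 p. 23] -/
theorem prop24_of_eval {c' : ℝ} (h1017 : Eval1017 c') (hnum : Prop24Main)
    (ha : FrakALowerBound) : Prop24 c' := by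
  obtain ⟨a₀, ha₀, ha⟩ := ha
  obtain ⟨D₁, hP⟩ := frakP_eventually_pos
  rw [Prop24Main] at hnum
  set d : ℝ := ‖dprime + dfrak‖ with hd
  set ε : ℝ := (d - 5) * a₀ / 2 with hε
  have hε0 : 0 < ε := by rw [hε]; nlinarith
  obtain ⟨D₀, h⟩ := (h1017 ε hε0).and ha
  refine ⟨max D₀ D₁, fun D _ χ hD hq hp hA => ?_⟩
  obtain ⟨h1, h2⟩ := h D χ (le_trans (le_max_left _ _) hD) hq hp
  have hPpos : 0 < frakP D := hP D (le_trans (le_max_right _ _) hD)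
  have haa : a₀ ≤ frakA χ := h2 hA
  have hmain : ‖(dprime + dfrak) * frakA χ * frakP D‖ = d * frakA χ * frakP D := by
    rw [norm_mul, norm_mul, Complex.norm_real, Complex.norm_real,
      Real.norm_of_nonneg (le_trans ha₀.le haa), Real.norm_of_nonneg hPpos.le]
  have htri : d * frakA χ * frakP D - ε * frakP D ≤ ‖xiStar1 c' χ‖ := by
    have := norm_sub_norm_le ((dprime + dfrak) * frakA χ * frakP D) (xiStar1 c' χ)
    rw [hmain, norm_sub_rev] at this
    linarith [h1 hA]
  have : 5 * frakA χ * frakP D < d * frakA χ * frakP D - ε * frakP D := by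
    have : ε = (d - 5) * a₀ / 2 := hε
    nlinarith [mul_le_mul_of_nonneg_right haa hPpos.le]
  linarith

/-! ## §18 p. 37: (2.33) from (18.3) and the crude bound -/

/-- **§18 p. 37, "This yields (2.33) by Lemma 8.1 and Proposition 7.1"**: `Ξ_J ≤ (8800/π)𝔞𝔓 + o(𝔓)`
with `8800/π < 2934 < 3000` and `𝔞 ≫ 1`. [cite: Zhang2022LandauSiegel, §18 p. 37] -/
theorem ineq233_of_bound {c' : ℝ} (h183 : Bound183 c') (ha : FrakALowerBound) : Ineq233 c' := by
  obtain ⟨a₀, ha₀, ha⟩ := ha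
  obtain ⟨D₁, hP⟩ := frakP_eventually_pos
  have hπ : 8800 / π < 2934 := by
    rw [div_lt_iff₀ Real.pi_pos]; nlinarith [Real.pi_gt_three]
  set ε : ℝ := 60 * a₀ with hε
  obtain ⟨D₀, h⟩ := (h183 ε (by positivity)).and ha
  refine ⟨max D₀ D₁, fun D _ χ hD hq hp hA => ?_⟩
  obtain ⟨h1, h2⟩ := h D χ (le_trans (le_max_left _ _) hD) hq hp
  have hPpos : 0 < frakP D := hP D (le_trans (le_max_right _ _) hD)
  have haa : a₀ ≤ frakA χ := h2 hA
  have hb := h1 hA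
  have : 8800 / π * frakA χ * frakP D ≤ 2934 * frakA χ * frakP D := by
    have := mul_nonneg (le_trans ha₀.le haa) hPpos.le
    nlinarith
  nlinarith [mul_le_mul_of_nonneg_right haa hPpos.le]

/-! ## §11 p. 23: Proposition 2.6 from (11.1) and `Ξ₁₂ ≪ 𝔞𝔓` -/

/-- **Cauchy's inequality for the weighted sums of §11**: `(Ξ₃*)² ≤ (ΣΣ𝔠*|J₁ − ZJ̄₂|²ω)·Ξ₁₂`
(weights `𝔠*ω ≥ 0` at every index). [cite: Zhang2022LandauSiegel, §11 p. 23] -/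
theorem xiStar3_sq_le {c' : ℝ} {D : ℕ} [NeZero D] (χ : DirichletCharacter ℂ D)
    (hw : ∀ i ∈ idx χ, 0 ≤ (cstar c' D i.1 i.2).re * (omegaW D i.2).re) :
    xiStar3 c' χ ^ 2 ≤ xi3sq c' χ * xi12 c' χ := by
  rw [xiStar3, xi3sq, xi12]
  have key := Finset.sum_mul_sq_le_sq_mul_sq (idx χ)
    (fun i => Real.sqrt ((cstar c' D i.1 i.2).re * (omegaW D i.2).re) *
      ‖J1 χ i.1 i.2 - Zpc χ i.1 i.2 * conj (J2 χ i.1 i.2)‖)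
    (fun i => Real.sqrt ((cstar c' D i.1 i.2).re * (omegaW D i.2).re) * ‖H2 χ i.1 i.2‖)
  have e1 : ∀ i ∈ idx χ,
      Real.sqrt ((cstar c' D i.1 i.2).re * (omegaW D i.2).re) *
          ‖J1 χ i.1 i.2 - Zpc χ i.1 i.2 * conj (J2 χ i.1 i.2)‖ *
        (Real.sqrt ((cstar c' D i.1 i.2).re * (omegaW D i.2).re) * ‖H2 χ i.1 i.2‖) =
      (cstar c' D i.1 i.2).re *
        (‖J1 χ i.1 i.2 - Zpc χ i.1 i.2 * conj (J2 χ i.1 i.2)‖ * ‖H2 χ i.1 i.2‖) *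
          (omegaW D i.2).re := by
    intro i hi
    have hs := Real.mul_self_sqrt (hw i hi)
    linear_combination (‖J1 χ i.1 i.2 - Zpc χ i.1 i.2 * conj (J2 χ i.1 i.2)‖ * ‖H2 χ i.1 i.2‖) * hs
  have e2 : ∀ i ∈ idx χ,
      (Real.sqrt ((cstar c' D i.1 i.2).re * (omegaW D i.2).re) *
          ‖J1 χ i.1 i.2 - Zpc χ i.1 i.2 * conj (J2 χ i.1 i.2)‖) ^ 2 =
      (cstar c' D i.1 i.2).re * ‖J1 χ i.1 i.2 - Zpc χ i.1 i.2 * conj (J2 χ i.1 i.2)‖ ^ 2 *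
        (omegaW D i.2).re := by
    intro i hi
    have hs := Real.sq_sqrt (hw i hi)
    rw [mul_pow, hs]; ring
  have e3 : ∀ i ∈ idx χ,
      (Real.sqrt ((cstar c' D i.1 i.2).re * (omegaW D i.2).re) * ‖H2 χ i.1 i.2‖) ^ 2 =
      (cstar c' D i.1 i.2).re * ‖H2 χ i.1 i.2‖ ^ 2 * (omegaW D i.2).re := by
    intro i hi
    have hs := Real.sq_sqrt (hw i hi)
    rw [mul_pow, hs]; ring
  rwa [Finset.sum_congr rfl e1, Finset.sum_congr rfl e2, Finset.sum_congr rfl e3] at key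

/-- **§11 p. 23: "By the result of Section 9, `Ξ₁₂ ≪ 𝔞𝔓`. Hence, by Cauchy's inequality, the
proof of Proposition 2.6 is reduced to showing (11.1)"**: (11.1) + (9.7) (as the bound
`Ξ₁₂ ≤ (𝔠₂ + 1)𝔞𝔓`) + Lemma 2.3, Prop. 2.2 (i) (non-negative real weights) + `𝔞 ≫ 1` ⇒ Prop. 2.6.
[cite: Zhang2022LandauSiegel, §11 p. 23] -/
theorem prop26_of_evals {c' : ℝ} (h22 : Prop22i) (h23 : Lemma23 c') (hprim : PsiChiPrimitive)
    (h111 : Eval111 c') (h97 : Eval97 c') (ha : FrakALowerBound) : Prop26 c' := by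
  intro ε hε
  obtain ⟨a₀, ha₀, ha⟩ := ha
  obtain ⟨D₁, hP⟩ := frakP_eventually_pos
  -- constants: `Ξ₁₂ ≤ K𝔞𝔓` with `K = |𝔠₂| + 1`, and `ε₁ = ε²/K` for (11.1)
  set K : ℝ := |frakc2.re| + 1 with hK
  have hK0 : 0 < K := by positivity
  set ε₁ : ℝ := ε ^ 2 / K with hε₁
  have hε₁0 : 0 < ε₁ := by positivity
  obtain ⟨D₀, h⟩ := ((((h22.and h23).and (h111 ε₁ hε₁0)).and (h97 a₀ ha₀)).and ha)
  refine ⟨max (max D₀ D₁) 3, fun D _ χ hD hq hp hA => ?_⟩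
  have hD3 : 3 ≤ D := le_trans (le_max_right _ _) hD
  have hD₀ : D₀ ≤ D := le_trans (le_trans (le_max_left _ _) (le_max_left _ _)) hD
  have hD₁ : D₁ ≤ D := le_trans (le_trans (le_max_right _ _) (le_max_left _ _)) hD
  obtain ⟨⟨⟨⟨h22', h23'⟩, h111'⟩, h97'⟩, ha'⟩ := h D χ hD₀ hq hp
  obtain ⟨hc, hω, -⟩ := pointwise_inputs c' χ hD3 h23' h22' (fun x => hprim D χ x hD3 hp)
  have hPpos : 0 < frakP D := hP D hD₁
  have haa : a₀ ≤ frakA χ := ha' hA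
  have hA0 : 0 < frakA χ := lt_of_lt_of_le ha₀ haa
  set X : ℝ := frakA χ * frakP D with hX
  have hX0 : 0 < X := mul_pos hA0 hPpos
  -- the two mean-square bounds
  have hsq : xi3sq c' χ ≤ ε₁ * X := by rw [hX, ← mul_assoc]; exact h111' hA
  have h12 : xi12 c' χ ≤ K * X := by
    have e2 := (abs_le.mp (h97' hA)).2
    have : a₀ * frakP D ≤ X := by rw [hX]; exact mul_le_mul_of_nonneg_right haa hPpos.le
    have : frakc2.re * frakA χ * frakP D ≤ |frakc2.re| * X := by
      rw [hX, ← mul_assoc]; exact mul_le_mul_of_nonneg_right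
        (mul_le_mul_of_nonneg_right (le_abs_self _) hA0.le) hPpos.le
    nlinarith
  -- Cauchy
  have hw : ∀ i ∈ idx χ, 0 ≤ (cstar c' D i.1 i.2).re * (omegaW D i.2).re :=
    fun i hi => mul_nonneg (hc i hi).2 (hω i hi).1.le
  have hcs := xiStar3_sq_le χ hw
  have h3nonneg : 0 ≤ xiStar3 c' χ := by
    rw [xiStar3]
    exact Finset.sum_nonneg fun i hi =>
      mul_nonneg (mul_nonneg (hc i hi).2 (by positivity)) (hω i hi).1.le
  have hsq0 : 0 ≤ xi3sq c' χ := by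
    rw [xi3sq]
    exact Finset.sum_nonneg fun i hi =>
      mul_nonneg (mul_nonneg (hc i hi).2 (by positivity)) (hω i hi).1.le
  have h12nonneg : 0 ≤ xi12 c' χ := by
    rw [xi12]
    exact Finset.sum_nonneg fun i hi =>
      mul_nonneg (mul_nonneg (hc i hi).2 (by positivity)) (hω i hi).1.le
  have hprod : xi3sq c' χ * xi12 c' χ ≤ (ε₁ * X) * (K * X) :=
    mul_le_mul hsq h12 h12nonneg (by positivity)
  have hεX : (ε₁ * X) * (K * X) = (ε * X) ^ 2 := by
    rw [hε₁]; field_simp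
  have hsq2 : xiStar3 c' χ ^ 2 ≤ (ε * X) ^ 2 := le_trans hcs (hεX ▸ hprod)
  have hfin : xiStar3 c' χ ≤ ε * X :=
    (pow_le_pow_iff_left₀ h3nonneg (by positivity) two_ne_zero).mp hsq2
  simpa [hX, mul_assoc] using hfin

/-! ## Theorem 1 modulo the evaluation layer -/

/-- **Theorem 1 modulo the second layer of the manuscript**: Prop. 2.2 (i), Lemma 2.3, the
evaluations (10.17), (8.23), (9.7), (18.1), (18.3)-with-crude-bound, (11.1), the numerical margin
`𝔠₁ + 𝔠₂ + 2Re 𝔠₃ < 0.001` (`Margin232` — certified FALSE for the constants as defined,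
`not_margin232` below) imply Theorem 1 — via `prop24_of_eval` (with the tree's
certified `|𝔡′ + 𝔡| > 5`, `Prop24Main_holds`), `ineq232_of_evals`, `ineq233_of_bound`,
`prop25_of_ineqs`, `prop26_of_evals`, `theorem1_of_props`, and `𝔞 ≫ 1` (Lemma 5.7 — DISCHARGED,
`frakALowerBound_holds`). An implication only; its remaining hypotheses are claims of the
manuscript, one of which (`Margin232`) is refuted in the kernel.
[cite: Zhang2022LandauSiegel, §2 p. 6, §18] -/
theorem theorem1_of_evaluations {c' : ℝ} (h22 : Prop22i) (h23 : Lemma23 c')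
    (h1017 : Eval1017 c') (h823 : Eval823 c') (h97 : Eval97 c') (h181 : Eval181 c')
    (hm : Margin232) (h183 : Bound183 c') (h111 : Eval111 c') : Theorem1 :=
  have ha : FrakALowerBound := frakALowerBound_holds
  have hprim : PsiChiPrimitive := psiChiPrimitive_holds
  theorem1_of_props h22 h23 (prop24_of_eval h1017 Prop24Main_holds ha)
    (prop25_of_ineqs h22 h23 hprim (ineq232_of_evals h22 h23 hprim h823 h97 h181 hm ha)
      (ineq233_of_bound h183 ha))
    (prop26_of_evals h22 h23 hprim h111 h97 ha)

/-! ## The numerical nodes against the tree's kernel certificates -/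

/-- **`Margin232` is FALSE for the constants as the manuscript defines them**: the tree's
interval-arithmetic certificates give `𝔠₁ > 7.0501` (`frakc1_re_bounds`; whence `not_ineq824`:
the printed (8.24) `𝔠₁ < 6.9955` fails, the slip being `Im c₁₂`), `𝔠₂ > 6.9949139`
(`frakc2_re_bounds`, with the prefactor of (9.5)–(9.6) as printed) and `Re 𝔠₃ > −6.990999`
(`frakc3_re_bounds`), so `𝔠₁ + 𝔠₂ + 2(Re 𝔠₃ + 10⁻⁵) > 0.063 > 0.001`. Hence the hypothesis
`hm : Margin232` of `ineq232_of_evals` / `theorem1_of_evaluations` cannot be discharged: it is the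
named hypothesis at which the manuscript's chain to (2.32), as printed, does not close.
[cite: Zhang2022LandauSiegel, §18 p. 36] -/
theorem not_margin232 : ¬ Margin232 := by
  rw [Margin232]
  have h1 := frakc1_re_bounds.1
  have h2 := frakc2_re_bounds.1
  have h3 := frakc3_re_bounds.1
  intro h
  linarith

/-- **The same failure in the reading most favourable to the manuscript**: with the corrected
prefactor `1/((0.5)(0.498)π)` of (9.5)–(9.6) (the tree's `frakc2c = 6.98709…`, the value that
reproduces the printed digits of `c₃₄`) and the rounding term of (18.1) taken with the favourable
sign, the total `𝔠₁ + 𝔠₂ + 2Re 𝔠₃` still exceeds `0.05` (the printed budget is `0.001`; the §2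
chain tolerates at most `5²/3000 < 0.0084`). [cite: Zhang2022LandauSiegel, §18 p. 36] -/
theorem margin232_total_gt : 0.05 < frakc1.re + frakc2c.re + 2 * (frakc3.re - 1e-5) := by
  have h1 := frakc1_re_bounds.1
  have h2 := frakc2c_re_bounds.1
  have h3 := frakc3_re_bounds.1
  linarith

/-- **The largest margin the §2 chain could tolerate**: Prop. 2.4 (`|Ξ₁*| > 5𝔞𝔓`), (2.18) and
Prop. 2.6 need `Ξ₂* < 5𝔞𝔓·(1 − o(1))`, and Cauchy with (2.33) (`Ξ_J < 3000𝔞𝔓`) gives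
`Ξ₂* ≤ √(m·3000)𝔞𝔓` from `Ξ₁ < m𝔞𝔓`; so any margin `m` with `3000m ≥ 25`, in particular
`m ≥ 0.0084`, is useless — and the certified total exceeds `0.05`. (Arithmetic only.)
[cite: Zhang2022LandauSiegel, §2 p. 6] -/
theorem margin_budget : (25 : ℝ) ≤ 3000 * 0.0084 ∧ (0.0084 : ℝ) < 0.05 := by norm_num

/-- **Proposition 2.4 from (10.17) alone**: the numerical input `|𝔡′ + 𝔡| > 5` is certified TRUE in
the tree (`Prop24Main_holds`, `|𝔡′ + 𝔡| = 5.29…`) and `𝔞 ≫ 1` is discharged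
(`frakALowerBound_holds`), so the node (10.17) implies Prop. 2.4 outright.
[cite: Zhang2022LandauSiegel, §10 p. 23] -/
theorem prop24_of_eval1017 {c' : ℝ} (h1017 : Eval1017 c') : Prop24 c' :=
  prop24_of_eval h1017 Prop24Main_holds frakALowerBound_holds

end Literature.NumberTheory.LFunctions.Zhang2022.Skeleton
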